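import Summits.Parity.BatemanHorn.Theses.VanishingDimension
import Literature.NumberTheory.Sieve.RosserSieveBetaOneBound

/-!
# Crux line `gamma-mixture` for `DimensionZeroSandwich` (route VanishingDimension, item stmt-Parity-18605)

**Idea.** The only non-classical feature of the crux is the quasi-multiplicative size law
`S(x;d,r) = ∏ᵢ (1 − tᵢ)^{z−1}`, `tᵢ = (∑_{p ∣ d, p ∣ fᵢ(r)} log p)/(deg fᵢ · log x) ∈ [0, θ]`, inside the
sieve main term `M^± = ∑_{d ∣ P} μ(d) χ^±(d) G_x(d)`, `G_x(d) = ∑_r g(d,r) S(x;d,r)`.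
Write `(1 − t)^{−(1−z)} = E[e^{t v}]`, `v ∼ Gamma(1 − z)`; then `G_x(d) = E_v[G_v(d)]` with `G_v`
MULTIPLICATIVE (`G_v(p) = ∑_{s : p ∣ F(s)} z^{cnt}/m_p · p^{(∑_{i : p ∣ fᵢ(s)} vᵢ/deg fᵢ)/log x} ≥ G_0(p) = g̃(p)`).
For each `v` the `β = 1` main-term identity gives `mainSum^± G_v = V(G_v) ± B^±_v` with `B^±_v ≥ 0`
(boundary sums), and since boundary moduli are `< D'² ≤ x^{2θ}`, `B^±_v ≤ e^{2θ|v|₁} B^±_0`,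
`V(G_v) ≤ V(g̃)`, `E[e^{2θ|v|₁}] ≤ 2^k` (`θ ≤ 1/4`). POSITIVITY of the boundary terms thus removes the
size law at the cost of the factor `2^k`, with NO sieve estimate uniform in `v` (this is how the line
dodges the `(θ log x)^{2κ}` loss of a termwise treatment flagged by the crux-attack refuter). What is
left is the undistorted `β = 1` sieve for `g̃` (dimension `κ = O(z)`) at `s = 1`:
`F_κ(1) − 1, 1 − f_κ(1) ≤ C κ` (Iwaniec 1980 Thm 1 / Lemma 20 for `κ ≤ 1/2`, `β = 1`; Greaves 2001
Lemma 4.2.5 (iii), §4.4.2), which the tree has for `κ = 1/2` (`Iwaniec1980_lemma20_of_half`) with a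
`κ`-general induction (`claims_all_one`).

Stubs: `stub_sieveDecomposition` (combinatorial sandwich in crux notation), `stub_mixturePositivity`
(the lever), `stub_tiltedDensity` (`g̃` multiplicative, `Ω(Cz, L)`, `V = vprod g̃`),
`stub_betaOneMainTermAtOne` (Lemma 20 at `β = 1`, `0 < κ ≤ 1/2`, `s = 1`), `stub_contTSmall`
(`T^±(1) = O(κ)`). Composition `DimensionZeroSandwich_of` is proved.
-/

noncomputable section

open scoped BigOperators ArithmeticFunction.Moebius
open Filter Asymptotics Finset Polynomial

namespace Summit.Parity.BatemanHorn.Cruxes.DimensionZeroSandwich.GammaMixture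

open Literature.NumberTheory.Sieve

/-! ### The objects of the crux, as definitions -/

variable {k : ℕ}

/-- The tilt `w(n) = z^{∑ᵢ ω(fᵢ(n))}`. -/
def tiltW (f : Fin k → ℤ[X]) (z : ℝ) (n : ℕ) : ℝ :=
  z ^ (∑ i, ArithmeticFunction.cardDistinctFactors (((f i).eval (n : ℤ)).toNat))

/-- The tilted mass `A₁(x) = ∑_{n ≤ x} w(n)`. -/
def tiltMass (f : Fin k → ℤ[X]) (z : ℝ) (x : ℕ) : ℝ :=
  ∑ n ∈ Finset.Icc 1 x, tiltW f z n

/-- The class mass `A(x;d,r) = ∑_{n ≤ x, n ≡ r (d)} w(n)`. -/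
def classMass (f : Fin k → ℤ[X]) (z : ℝ) (x d r : ℕ) : ℝ :=
  ∑ n ∈ (Finset.Icc 1 x).filter (fun n : ℕ => n ≡ r [MOD d]), tiltW f z n

/-- `cnt p s = #{i : p ∣ fᵢ(s)}`. -/
def cnt (f : Fin k → ℤ[X]) (p s : ℕ) : ℕ :=
  (Finset.univ.filter (fun i => (p : ℤ) ∣ (f i).eval (s : ℤ))).card

/-- `m_p = ∑_{s mod p} z^{cnt p s}`. -/
def mloc (f : Fin k → ℤ[X]) (z : ℝ) (p : ℕ) : ℝ :=
  ∑ s ∈ Finset.range p, z ^ cnt f p s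

/-- The exact local factor `g(d,r) = ∏_{p ∣ d} z^{cnt p r}/m_p`. -/
def gloc (f : Fin k → ℤ[X]) (z : ℝ) (d r : ℕ) : ℝ :=
  ∏ p ∈ d.primeFactors, z ^ cnt f p r / mloc f z p

/-- The size law `S(x;d,r) = ∏ᵢ (1 − (∑_{p ∣ d, p ∣ fᵢ(r)} log p)/(deg fᵢ · log x))^{z−1}`. -/
def sizeLaw (f : Fin k → ℤ[X]) (z : ℝ) (x d r : ℕ) : ℝ :=
  ∏ i, (1 - (∑ p ∈ d.primeFactors.filter (fun p : ℕ => (p : ℤ) ∣ (f i).eval (r : ℤ)), Real.log p) /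
    (((f i).natDegree : ℝ) * Real.log x)) ^ (z - 1)

/-- The sifted density `V(x) = ∏_{p < ⌊x^θ⌋} (p − ρ_F(p))/m_p`. -/
def Vx (f : Fin k → ℤ[X]) (z θ : ℝ) (x : ℕ) : ℝ :=
  ∏ p ∈ (Finset.range ⌊(x : ℝ) ^ θ⌋₊).filter Nat.Prime, ((p : ℝ) - polyRootCountMod f p) / mloc f z p

/-- The jointly `⌊x^θ⌋`-rough arguments `n ≤ x`. -/
def roughSet (f : Fin k → ℤ[X]) (θ : ℝ) (x : ℕ) : Finset ℕ :=
  (Finset.Icc 1 x).filter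
    (fun n : ℕ => ∀ i, ∀ p ∈ Finset.range ⌊(x : ℝ) ^ θ⌋₊, p.Prime → ¬ ((p : ℤ) ∣ (f i).eval (n : ℤ)))

/-- The root classes `r mod d` with `d ∣ ∏ᵢ fᵢ(r)`. -/
def rootClasses (f : Fin k → ℤ[X]) (d : ℕ) : Finset ℕ :=
  (Finset.range d).filter (fun r : ℕ => (d : ℤ) ∣ ∏ i, (f i).eval (r : ℤ))

/-- The `ℓ¹` level error of the crux hypothesis (K1 at `(θ, z)`). -/
def levelErr (f : Fin k → ℤ[X]) (z θ : ℝ) (x : ℕ) : ℝ :=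
  ∑ d ∈ (Finset.Icc 1 ⌊(x : ℝ) ^ θ⌋₊).filter Squarefree, ∑ r ∈ rootClasses f d,
    |classMass f z x d r - gloc f z d r * sizeLaw f z x d r * tiltMass f z x|

/-- The sieve level / sifting range `D' = ⌊x^θ⌋₊`. -/
def level (θ : ℝ) (x : ℕ) : ℕ := ⌊(x : ℝ) ^ θ⌋₊

/-- The size-law-weighted local mass `G_x(d) = ∑_r g(d,r) S(x;d,r)`. -/
def Gx (f : Fin k → ℤ[X]) (z : ℝ) (x d : ℕ) : ℝ :=
  ∑ r ∈ rootClasses f d, gloc f z d r * sizeLaw f z x d r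

/-- The main terms `M^{par}(x) = ∑_{d ∣ P(D')} μ(d) χ^{par}(d) G_x(d)` of Rosser's `β = 1` weights of
level `D'` over `P(D')`. -/
def mainM (f : Fin k → ℤ[X]) (z θ : ℝ) (par : ℕ) (x : ℕ) : ℝ :=
  ∑ d ∈ (primesProdBelow (level θ x : ℝ)).divisors,
    (μ d : ℝ) * BetaSieve.ind par 1 (level θ x : ℝ) d * Gx f z x d

/-- The undistorted tilted density `g̃(d) = ∑_r g(d,r)` as an arithmetic function. -/
def gtilde (f : Fin k → ℤ[X]) (z : ℝ) : ArithmeticFunction ℝ :=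
  ⟨fun d => ∑ r ∈ rootClasses f d, gloc f z d r, by simp [rootClasses]⟩

/-! ### The stubs -/

/-- **Stub 1 (combinatorial sieve decomposition).** With `w ≥ 0`, the `β = 1` Rosser weights of level
`D' = ⌊x^θ⌋₊ ≥ 2` over `P(D')` sandwich the rough tilted mass between `A₁ M⁰ − E` and `A₁ M¹ + E`, `E` the
`ℓ¹` level error: `upper_sieve`/`lower_sieve` on `∏_{p < D', p ∣ F(n)} p`, residue classes mod `d`,
`A_d = ∑_r A(x;d,r) = A₁ G_x(d) + ∑_r E(d,r)`, and `χ(d) ≠ 0 ⇒ d < D'`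
(`BetaSieve.lt_level_of_pred_of_one_le`). -/
theorem stub_sieveDecomposition : ∀ (k : ℕ) (f : Fin k → ℤ[X]) (z θ : ℝ) (x : ℕ), 0 ≤ z → 2 ≤ level θ x →
    tiltMass f z x * mainM f z θ 0 x - levelErr f z θ x ≤ ∑ n ∈ roughSet f θ x, tiltW f z n ∧
    ∑ n ∈ roughSet f θ x, tiltW f z n ≤ tiltMass f z x * mainM f z θ 1 x + levelErr f z θ x := by
  sorry

/-- **Stub 2 (Gamma-mixture positivity — the lever).** For a Bateman–Horn system, `0 < θ ≤ 1/4` and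
small `z`, eventually in `x`: `M¹ ≤ (1 + Cz) V(g̃) + 2^k (S⁺(g̃) − V(g̃))` and
`M⁰ ≥ (1 − Cz) V(g̃) − 2^k (V(g̃) − S⁻(g̃))`, where `S^±(g̃) = BetaSieve.mainSum par g̃ 1 D' P(D')` are the
UNDISTORTED `β = 1` main sums. Proof sketch: `S = E_v[∏ e^{tᵢvᵢ}]` (`vᵢ ∼ Gamma(1−z)`), `G_x = E_v[G_v]`,
`G_v` multiplicative; `mainTerm_identity` per `v`; boundary moduli `< D'²` so `B_v ≤ e^{2θ|v|₁} B_0`,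
`vlt G_v ≤ vlt G_0`, `E[e^{2θ|v|₁}] ≤ 2^k`; `E[V(G_v)] ≥ V(g̃)(1 − Cz)`; tail `|v|₁ > (log x)/2` trivial. -/
theorem stub_mixturePositivity : ∀ (k : ℕ) (f : Fin k → ℤ[X]), IsBatemanHornSystem f →
    ∀ θ : ℝ, 0 < θ → θ ≤ 1 / 4 → ∃ z₀ : ℝ, 0 < z₀ ∧ ∃ C : ℝ, 0 ≤ C ∧ ∀ z : ℝ, 0 < z → z < z₀ →
      ∀ᶠ x : ℕ in atTop,
        mainM f z θ 1 x ≤ (1 + C * z) * BetaSieve.vprod (gtilde f z) (primesProdBelow (level θ x : ℝ)) +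
            2 ^ k * (BetaSieve.mainSum 1 (gtilde f z) 1 (level θ x : ℝ) (primesProdBelow (level θ x : ℝ)) -
              BetaSieve.vprod (gtilde f z) (primesProdBelow (level θ x : ℝ))) ∧
        (1 - C * z) * BetaSieve.vprod (gtilde f z) (primesProdBelow (level θ x : ℝ)) -
            2 ^ k * (BetaSieve.vprod (gtilde f z) (primesProdBelow (level θ x : ℝ)) -
              BetaSieve.mainSum 0 (gtilde f z) 1 (level θ x : ℝ) (primesProdBelow (level θ x : ℝ))) ≤
          mainM f z θ 0 x := by
  sorry

/-- **Stub 3 (the tilted density).** For a Bateman–Horn system and small `z > 0`, `g̃` is multiplicative,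
satisfies Iwaniec's `Ω(Cz, L)` (`ρ_F(p) ≤ deg F`, no fixed prime divisor, Mertens), and the crux's `V(x)`
is `∏_{p < D'} (1 − g̃(p)) = BetaSieve.vprod g̃ (P(D'))` (`1 − g̃(p) = (p − ρ_F(p))/m_p`). -/
theorem stub_tiltedDensity : ∀ (k : ℕ) (f : Fin k → ℤ[X]), IsBatemanHornSystem f →
    ∃ z₀ : ℝ, 0 < z₀ ∧ ∃ C L : ℝ, 0 < C ∧ ∀ z : ℝ, 0 < z → z < z₀ →
      (gtilde f z).IsMultiplicative ∧ HasIwaniecDimension (gtilde f z) (C * z) L ∧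
      ∀ (θ : ℝ) (x : ℕ), Vx f z θ x = BetaSieve.vprod (gtilde f z) (primesProdBelow (level θ x : ℝ)) := by
  sorry

/-- **Stub 4 (Iwaniec's Lemma 20 at `β = 1`, `0 < κ ≤ 1/2`, at `s = 1`).** For multiplicative `g` with
`Ω(κ, L)`, `0 < κ ≤ 1/2`, and `D ≥ D₀(κ, L)`: the boundary sums of Rosser's `β = 1` weights of level `D`
over `P(D)` satisfy `∑_{n ≤ N} T^±_n(D, P(D)) ≤ V(P(D)) (T^±_N(1) + C (log D)^{−1/3})` with Iwaniec's
continuous models `T^±_N = BetaSieve.contT par κ 1 N`. (Iwaniec 1980 Lemma 20, (8.8)–(8.9); Greaves 2001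
§4.4.2. The tree proves `κ = 1/2` (`BetaSieve.Iwaniec1980_lemma20_of_half`); the induction
`BetaSieve.claims_all_one` is already stated for `0 < κ ≤ 1/2`, and the `κ = 1/2` majorant package serves
all `κ ≤ 1/2` since `sieveKernel κ ≤ sieveKernel (1/2)` and `contS κ 1 n ≤ contS (1/2) 1 n`; the endpoint
`s = 1` of the lower parity is reached by `exists_lt_primesProdBelow_eq` + `contT_antitoneOn_one`.) -/
theorem stub_betaOneMainTermAtOne : ∀ κ : ℝ, 0 < κ → κ ≤ 1 / 2 → ∀ L : ℝ, ∃ C D₀ : ℝ,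
    ∀ g : ArithmeticFunction ℝ, g.IsMultiplicative → HasIwaniecDimension g κ L → ∀ D : ℝ, D₀ ≤ D →
      ∀ N : ℕ,
        BetaSieve.discT 0 g 1 D (primesProdBelow D) N ≤
            BetaSieve.vprod g (primesProdBelow D) *
              (BetaSieve.contT 0 κ 1 N 1 + C * Real.log D ^ (-(1 / 3 : ℝ))) ∧
        BetaSieve.discT 1 g 1 D (primesProdBelow D) N ≤
            BetaSieve.vprod g (primesProdBelow D) *
              (BetaSieve.contT 1 κ 1 N 1 + C * Real.log D ^ (-(1 / 3 : ℝ))) := by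
  sorry

/-- **Stub 5 (the continuous models vanish with the dimension).** Iwaniec's partial sums at `β = 1`,
`s = 1` satisfy `T^±_N(1) ≤ C κ` for all `N` once `κ ≤ κ₀`: `S_1(1) = 2^κ − 1 ≤ κ 2^κ log 2`,
`S_2(1) = ∫_1^3 κ t^{κ−1}(t−1)^{−κ} (2^κ − min(t−1,2)^κ) dt = O(κ²)`, and for `n ≥ 2` the weighted bound
`S_n(s) ≤ (3eκ)^{n−2} C κ² e^{3−s}` (each kernel integration costs `≤ κ e (2 + 1) e^{−s}`), a convergent
geometric series for `κ < 1/(3e)`. Equivalently `F_κ(1), f_κ(1) → 1` (Greaves 2001, Lemma 4.2.5 (iii),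
(4.14): `B, C → 1` as `κ → 0`). -/
theorem stub_contTSmall : ∃ κ₀ : ℝ, 0 < κ₀ ∧ ∃ C : ℝ, ∀ κ : ℝ, 0 < κ → κ ≤ κ₀ → ∀ N : ℕ,
    BetaSieve.contT 0 κ 1 N 1 ≤ C * κ ∧ BetaSieve.contT 1 κ 1 N 1 ≤ C * κ := by
  sorry

/-! ### Composition -/

/-- `w ≥ 0` for `z ≥ 0`. -/
theorem tiltW_nonneg (f : Fin k → ℤ[X]) {z : ℝ} (hz : 0 ≤ z) (n : ℕ) : 0 ≤ tiltW f z n :=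
  pow_nonneg hz _

/-- `A₁ ≥ 0` for `z ≥ 0`. -/
theorem tiltMass_nonneg (f : Fin k → ℤ[X]) {z : ℝ} (hz : 0 ≤ z) (x : ℕ) : 0 ≤ tiltMass f z x :=
  Finset.sum_nonneg fun n _ => tiltW_nonneg f hz n

/-- `D' = ⌊x^θ⌋₊ → ∞`. -/
theorem tendsto_level {θ : ℝ} (hθ : 0 < θ) : Tendsto (fun x : ℕ => level θ x) atTop atTop :=
  tendsto_nat_floor_atTop.comp ((tendsto_rpow_atTop hθ).comp tendsto_natCast_atTop_atTop)

/-- `(log D')^{−1/3} → 0`. -/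
theorem tendsto_log_level_rpow {θ : ℝ} (hθ : 0 < θ) :
    Tendsto (fun x : ℕ => Real.log (level θ x : ℝ) ^ (-(1 / 3 : ℝ))) atTop (nhds 0) := by
  have h1 : Tendsto (fun x : ℕ => ((level θ x : ℕ) : ℝ)) atTop atTop :=
    tendsto_natCast_atTop_atTop.comp (tendsto_level hθ)
  have h2 : Tendsto (fun x : ℕ => Real.log ((level θ x : ℕ) : ℝ)) atTop atTop :=
    Real.tendsto_log_atTop.comp h1
  exact (tendsto_rpow_neg_atTop (by norm_num : (0 : ℝ) < 1 / 3)).comp h2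

/-- The unfolded sandwich: from the five stubs, for every Bateman–Horn system, `0 < θ ≤ 1/4` and `ε > 0`
there is `z₁ > 0` such that for `0 < z < z₁` the relative level hypothesis implies the eventual two-sided
bound `|∑_{rough} w − A₁ V| ≤ ε A₁ V`. -/
theorem sandwich_of_stubs
    (h1 : ∀ (k : ℕ) (f : Fin k → ℤ[X]) (z θ : ℝ) (x : ℕ), 0 ≤ z → 2 ≤ level θ x →
      tiltMass f z x * mainM f z θ 0 x - levelErr f z θ x ≤ ∑ n ∈ roughSet f θ x, tiltW f z n ∧
      ∑ n ∈ roughSet f θ x, tiltW f z n ≤ tiltMass f z x * mainM f z θ 1 x + levelErr f z θ x)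
    (h2 : ∀ (k : ℕ) (f : Fin k → ℤ[X]), IsBatemanHornSystem f →
      ∀ θ : ℝ, 0 < θ → θ ≤ 1 / 4 → ∃ z₀ : ℝ, 0 < z₀ ∧ ∃ C : ℝ, 0 ≤ C ∧ ∀ z : ℝ, 0 < z → z < z₀ →
        ∀ᶠ x : ℕ in atTop,
          mainM f z θ 1 x ≤ (1 + C * z) * BetaSieve.vprod (gtilde f z) (primesProdBelow (level θ x : ℝ)) +
              2 ^ k * (BetaSieve.mainSum 1 (gtilde f z) 1 (level θ x : ℝ) (primesProdBelow (level θ x : ℝ)) -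
                BetaSieve.vprod (gtilde f z) (primesProdBelow (level θ x : ℝ))) ∧
          (1 - C * z) * BetaSieve.vprod (gtilde f z) (primesProdBelow (level θ x : ℝ)) -
              2 ^ k * (BetaSieve.vprod (gtilde f z) (primesProdBelow (level θ x : ℝ)) -
                BetaSieve.mainSum 0 (gtilde f z) 1 (level θ x : ℝ) (primesProdBelow (level θ x : ℝ))) ≤
            mainM f z θ 0 x)
    (h3 : ∀ (k : ℕ) (f : Fin k → ℤ[X]), IsBatemanHornSystem f →
      ∃ z₀ : ℝ, 0 < z₀ ∧ ∃ C L : ℝ, 0 < C ∧ ∀ z : ℝ, 0 < z → z < z₀ →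
        (gtilde f z).IsMultiplicative ∧ HasIwaniecDimension (gtilde f z) (C * z) L ∧
        ∀ (θ : ℝ) (x : ℕ), Vx f z θ x = BetaSieve.vprod (gtilde f z) (primesProdBelow (level θ x : ℝ)))
    (h4 : ∀ κ : ℝ, 0 < κ → κ ≤ 1 / 2 → ∀ L : ℝ, ∃ C D₀ : ℝ,
      ∀ g : ArithmeticFunction ℝ, g.IsMultiplicative → HasIwaniecDimension g κ L → ∀ D : ℝ, D₀ ≤ D →
        ∀ N : ℕ,
          BetaSieve.discT 0 g 1 D (primesProdBelow D) N ≤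
              BetaSieve.vprod g (primesProdBelow D) *
                (BetaSieve.contT 0 κ 1 N 1 + C * Real.log D ^ (-(1 / 3 : ℝ))) ∧
          BetaSieve.discT 1 g 1 D (primesProdBelow D) N ≤
              BetaSieve.vprod g (primesProdBelow D) *
                (BetaSieve.contT 1 κ 1 N 1 + C * Real.log D ^ (-(1 / 3 : ℝ))))
    (h5 : ∃ κ₀ : ℝ, 0 < κ₀ ∧ ∃ C : ℝ, ∀ κ : ℝ, 0 < κ → κ ≤ κ₀ → ∀ N : ℕ,
      BetaSieve.contT 0 κ 1 N 1 ≤ C * κ ∧ BetaSieve.contT 1 κ 1 N 1 ≤ C * κ)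
    (k : ℕ) (f : Fin k → ℤ[X]) (hf : IsBatemanHornSystem f) (θ : ℝ) (hθ : 0 < θ) (hθ' : θ ≤ 1 / 4)
    (ε : ℝ) (hε : 0 < ε) :
    ∃ z₁ : ℝ, 0 < z₁ ∧ ∀ z : ℝ, 0 < z → z < z₁ →
      ((fun x : ℕ => levelErr f z θ x) =o[atTop] fun x : ℕ => tiltMass f z x * Vx f z θ x) →
      ∀ᶠ x : ℕ in atTop, |(∑ n ∈ roughSet f θ x, tiltW f z n) - tiltMass f z x * Vx f z θ x| ≤
        ε * (tiltMass f z x * Vx f z θ x) := by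
  -- constants from the stubs
  obtain ⟨z₂, hz₂, C₂, hC₂, H2⟩ := h2 k f hf θ hθ hθ'
  obtain ⟨z₃, hz₃, C₃, L₃, hC₃, H3⟩ := h3 k f hf
  obtain ⟨κ₀, hκ₀, C₅, H5⟩ := h5
  -- `C₅ ≥ 0` may fail a priori; replace by `max C₅ 0`
  set C₅' := max C₅ 0 with hC₅'def
  have hC₅' : 0 ≤ C₅' := le_max_right _ _
  have H5' : ∀ κ : ℝ, 0 < κ → κ ≤ κ₀ → ∀ N : ℕ,
      BetaSieve.contT 0 κ 1 N 1 ≤ C₅' * κ ∧ BetaSieve.contT 1 κ 1 N 1 ≤ C₅' * κ := by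
    intro κ hκ hκ' N
    obtain ⟨a, b⟩ := H5 κ hκ hκ' N
    exact ⟨a.trans (mul_le_mul_of_nonneg_right (le_max_left _ _) hκ.le),
      b.trans (mul_le_mul_of_nonneg_right (le_max_left _ _) hκ.le)⟩
  -- the rate constant `K = C₂ + 2^k C₅' C₃`, and the choice of `z₁`
  set K : ℝ := C₂ + 2 ^ k * C₅' * C₃ with hKdef
  have hK : 0 ≤ K := add_nonneg hC₂ (mul_nonneg (mul_nonneg (pow_nonneg zero_le_two _) hC₅') hC₃.le)
  have hK1pos : 0 < 4 * (K + 1) := by linarith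
  have h2C₃ : 0 < 2 * C₃ := by linarith
  set z₁ : ℝ := min (min z₂ z₃) (min (min (κ₀ / C₃) (1 / (2 * C₃))) (ε / (4 * (K + 1)))) with hz₁def
  have hz₁ : 0 < z₁ :=
    lt_min (lt_min hz₂ hz₃)
      (lt_min (lt_min (div_pos hκ₀ hC₃) (div_pos one_pos h2C₃)) (div_pos hε hK1pos))
  refine ⟨z₁, hz₁, fun z hz hzlt hK1 => ?_⟩
  have hz2 : z < z₂ := lt_of_lt_of_le hzlt ((min_le_left _ _).trans (min_le_left _ _))
  have hz3 : z < z₃ := lt_of_lt_of_le hzlt ((min_le_left _ _).trans (min_le_right _ _))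
  have hzκ : z < κ₀ / C₃ :=
    lt_of_lt_of_le hzlt ((min_le_right _ _).trans ((min_le_left _ _).trans (min_le_left _ _)))
  have hzhalf : z < 1 / (2 * C₃) :=
    lt_of_lt_of_le hzlt ((min_le_right _ _).trans ((min_le_left _ _).trans (min_le_right _ _)))
  have hzε : z < ε / (4 * (K + 1)) := lt_of_lt_of_le hzlt ((min_le_right _ _).trans (min_le_right _ _))
  -- the density `g̃` at this `z`
  obtain ⟨hmult, hdim, hV⟩ := H3 z hz hz3
  set κ : ℝ := C₃ * z with hκdef
  have hκ : 0 < κ := mul_pos hC₃ hz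
  have hκ₀ : κ ≤ κ₀ := by
    have h := hzκ
    rw [lt_div_iff₀ hC₃] at h
    rw [hκdef]; linarith
  have hκhalf : κ ≤ 1 / 2 := by
    have h := hzhalf
    rw [lt_div_iff₀ h2C₃] at h
    rw [hκdef]; linarith
  obtain ⟨C₄, D₀, H4⟩ := h4 κ hκ hκhalf L₃
  -- `K z ≤ ε/4`
  have hKz : K * z ≤ ε / 4 := by
    have h := hzε
    rw [lt_div_iff₀ hK1pos] at h
    have hz0 := hz.le
    linarith
  -- the eventual facts
  have hE2 := H2 z hz hz2
  have hElev : ∀ᶠ x : ℕ in atTop, 2 ≤ level θ x ∧ D₀ ≤ (level θ x : ℝ) := by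
    have hl := tendsto_level hθ
    filter_upwards [hl.eventually_ge_atTop (max 2 ⌈D₀⌉₊)] with x hx
    refine ⟨le_trans (le_max_left _ _) hx, ?_⟩
    have : (⌈D₀⌉₊ : ℝ) ≤ (level θ x : ℝ) := by exact_mod_cast le_trans (le_max_right _ _) hx
    exact (Nat.le_ceil D₀).trans this
  have hElog : ∀ᶠ x : ℕ in atTop, 2 ^ k * (|C₄| * Real.log (level θ x : ℝ) ^ (-(1 / 3 : ℝ))) ≤ ε / 4 := by
    have ht := tendsto_log_level_rpow hθ
    have ht' : Tendsto (fun x : ℕ => 2 ^ k * (|C₄| * Real.log (level θ x : ℝ) ^ (-(1 / 3 : ℝ)))) atTop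
        (nhds (2 ^ k * (|C₄| * 0))) := (ht.const_mul _).const_mul _
    rw [mul_zero, mul_zero] at ht'
    exact ((tendsto_order.1 ht').2 (ε / 4) (by positivity)).mono fun x hx => hx.le
  have hEK1 : ∀ᶠ x : ℕ in atTop, ‖levelErr f z θ x‖ ≤ ε / 4 * ‖tiltMass f z x * Vx f z θ x‖ :=
    hK1.def (by positivity)
  filter_upwards [hE2, hElev, hElog, hEK1] with x hx2 hxlev hxlog hxK1
  obtain ⟨hlev2, hlevD⟩ := hxlev
  -- notation
  set D' : ℕ := level θ x with hD'
  set P : ℕ := primesProdBelow (D' : ℝ) with hP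
  set g := gtilde f z with hg
  set V := BetaSieve.vprod g P with hVdef
  have hVpos : 0 < V := hdim.vprod_pos (D' : ℝ)
  have hVx : Vx f z θ x = V := hV θ x
  have hA : 0 ≤ tiltMass f z x := tiltMass_nonneg f hz.le x
  have hAV : 0 ≤ tiltMass f z x * V := mul_nonneg hA hVpos.le
  -- the undistorted β = 1 sieve at s = 1
  have hPsq : Squarefree P := squarefree_primesProdBelow _
  set N := P.primeFactors.card with hN
  obtain ⟨h40, h41⟩ := H4 g hmult hdim (D' : ℝ) hlevD N
  obtain ⟨h50, h51⟩ := H5' κ hκ hκ₀ N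
  set ℓ := Real.log (D' : ℝ) ^ (-(1 / 3 : ℝ)) with hℓ
  have hℓ0 : 0 ≤ ℓ := Real.rpow_nonneg (Real.log_natCast_nonneg _) _
  have hC₄ℓ : C₄ * ℓ ≤ |C₄| * ℓ := mul_le_mul_of_nonneg_right (le_abs_self _) hℓ0
  have hS1 : BetaSieve.mainSum 1 g 1 (D' : ℝ) P - V ≤ V * (C₅' * κ + |C₄| * ℓ) := by
    have hid := BetaSieve.mainSum_eq_vprod_sub_discT hmult hPsq 1 (1 : ℝ) (D' : ℝ)
    rw [pow_one] at hid
    have heq : BetaSieve.mainSum 1 g 1 (D' : ℝ) P - V = BetaSieve.discT 1 g 1 (D' : ℝ) P N := by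
      rw [hid, hVdef, hN]; ring
    rw [heq]
    refine h41.trans (mul_le_mul_of_nonneg_left ?_ hVpos.le)
    linarith
  have hS0 : V - BetaSieve.mainSum 0 g 1 (D' : ℝ) P ≤ V * (C₅' * κ + |C₄| * ℓ) := by
    have hid := BetaSieve.mainSum_eq_vprod_sub_discT hmult hPsq 0 (1 : ℝ) (D' : ℝ)
    rw [pow_zero, one_mul] at hid
    have heq : V - BetaSieve.mainSum 0 g 1 (D' : ℝ) P = BetaSieve.discT 0 g 1 (D' : ℝ) P N := by
      rw [hid, hVdef, hN]; ring
    rw [heq]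
    refine h40.trans (mul_le_mul_of_nonneg_left ?_ hVpos.le)
    linarith
  -- the total relative error
  have herr : C₂ * z + 2 ^ k * (C₅' * κ + |C₄| * ℓ) ≤ 3 * ε / 4 := by
    have hKz' : C₂ * z + 2 ^ k * (C₅' * κ) = K * z := by rw [hKdef, hκdef]; ring
    have hε0 := hε.le
    linarith
  obtain ⟨hup, hlo⟩ := hx2
  obtain ⟨hlo1, hup1⟩ := h1 k f z θ x hz.le hlev2
  have h2k : (0 : ℝ) ≤ 2 ^ k := pow_nonneg zero_le_two _
  -- upper bound for `M¹`
  have hM1 : mainM f z θ 1 x ≤ V * (1 + 3 * ε / 4) := by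
    have step : 2 ^ k * (BetaSieve.mainSum 1 g 1 (D' : ℝ) P - V) ≤ 2 ^ k * (V * (C₅' * κ + |C₄| * ℓ)) :=
      mul_le_mul_of_nonneg_left hS1 h2k
    have step2 : V * (C₂ * z + 2 ^ k * (C₅' * κ + |C₄| * ℓ)) ≤ V * (3 * ε / 4) :=
      mul_le_mul_of_nonneg_left herr hVpos.le
    have hexp : (1 + C₂ * z) * V + 2 ^ k * (V * (C₅' * κ + |C₄| * ℓ)) =
        V + V * (C₂ * z + 2 ^ k * (C₅' * κ + |C₄| * ℓ)) := by ring
    have hexp2 : V * (1 + 3 * ε / 4) = V + V * (3 * ε / 4) := by ring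
    linarith
  -- lower bound for `M⁰`
  have hM0 : V * (1 - 3 * ε / 4) ≤ mainM f z θ 0 x := by
    have step : 2 ^ k * (V - BetaSieve.mainSum 0 g 1 (D' : ℝ) P) ≤ 2 ^ k * (V * (C₅' * κ + |C₄| * ℓ)) :=
      mul_le_mul_of_nonneg_left hS0 h2k
    have step2 : V * (C₂ * z + 2 ^ k * (C₅' * κ + |C₄| * ℓ)) ≤ V * (3 * ε / 4) :=
      mul_le_mul_of_nonneg_left herr hVpos.le
    have hexp : (1 - C₂ * z) * V - 2 ^ k * (V * (C₅' * κ + |C₄| * ℓ)) =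
        V - V * (C₂ * z + 2 ^ k * (C₅' * κ + |C₄| * ℓ)) := by ring
    have hexp2 : V * (1 - 3 * ε / 4) = V - V * (3 * ε / 4) := by ring
    linarith
  -- the level error
  have hE : levelErr f z θ x ≤ ε / 4 * (tiltMass f z x * V) := by
    have h := hxK1
    rw [hVx, Real.norm_eq_abs, Real.norm_eq_abs, abs_of_nonneg hAV] at h
    exact (le_abs_self _).trans h
  -- assemble
  have hM0' : tiltMass f z x * (V * (1 - 3 * ε / 4)) ≤ tiltMass f z x * mainM f z θ 0 x :=
    mul_le_mul_of_nonneg_left hM0 hA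
  have hM1' : tiltMass f z x * mainM f z θ 1 x ≤ tiltMass f z x * (V * (1 + 3 * ε / 4)) :=
    mul_le_mul_of_nonneg_left hM1 hA
  have hexp3 : tiltMass f z x * (V * (1 - 3 * ε / 4)) =
      tiltMass f z x * V - 3 / 4 * (ε * (tiltMass f z x * V)) := by ring
  have hexp4 : tiltMass f z x * (V * (1 + 3 * ε / 4)) =
      tiltMass f z x * V + 3 / 4 * (ε * (tiltMass f z x * V)) := by ring
  have hexp5 : ε / 4 * (tiltMass f z x * V) = 1 / 4 * (ε * (tiltMass f z x * V)) := by ring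
  rw [hVx, abs_le]
  constructor
  · linarith
  · linarith

/-- **Composition.** The five stubs imply the crux `DimensionZeroSandwich` BY NAME (the crux's `let`s
unfold definitionally to the definitions of this file; the stubs are invoked by name). -/
theorem DimensionZeroSandwich_of :
    Summit.Parity.BatemanHorn.Theses.VanishingDimension.DimensionZeroSandwich := by
  intro k f hf θ hθ hθ' ε hε
  obtain ⟨z₁, hz₁, H⟩ := sandwich_of_stubs stub_sieveDecomposition stub_mixturePositivity
    stub_tiltedDensity stub_betaOneMainTermAtOne stub_contTSmall k f hf θ hθ hθ' ε hε
  refine ⟨z₁, hz₁, fun z hz hzlt => ?_⟩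
  exact H z hz hzlt

end Summit.Parity.BatemanHorn.Cruxes.DimensionZeroSandwich.GammaMixture
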